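import Literature.AlgebraicGeometry.Modules.LinearOverBase
import Literature.AlgebraicGeometry.Modules.SectionsExact
import Literature.AlgebraicGeometry.Modules.IdealMul
import Literature.AlgebraicGeometry.Motives.ChernClassesProofs
import Mathlib.CategoryTheory.Preadditive.Biproducts
import Mathlib.CategoryTheory.Preadditive.AdditiveFunctor
import HarnessLib

/-!
# Isogeny bounds: invariance under isomorphisms, finite direct sums, and the passage to sections

Helper file toward the crux `PadicSemiregularLift.FormalVectorBundlesAlgebraize`
(stmt-HodgeConjecture-14106), proper case via a Chow cover. The roof lemma
(`Literature/…/Morphisms/FormalModuleIsogenyRoof`) consumes, for a morphism `v : A → B` and a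
central endomorphism `ε` (multiplication by a power of a global function), the two ISOGENY BOUNDS
"the kernel of `v` is killed by `ε`" and "the cokernel of `v` is killed by `ε`", in the
generalized-element forms `z ≫ v = 0 → z ≫ ε = 0` and `v ≫ q = 0 → ε ≫ q = 0`. This file records
the bookkeeping used to establish them for the unit `M → ρ_*ρ^*M` of a Chow cover:

* §1 (any abelian category): the bounds are stable under pre- and post-composition with epimorphisms and monomorphisms
  (`kerBound_comp_mono`, `kerBound_mono_comp`, `cokerBound_epi_comp`, `cokerBound_comp_epi`), and,
  for the components `η_A` of a natural transformation `η : 𝟭 → R` into an ADDITIVE functor, under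
  finite biproducts (`kerBound_biproduct`, `cokerBound_biproduct`);
* §2 (`𝒪_X`-modules, `ε =` multiplication by `aᶜ`): translation between the generalized-element
  forms, the forms `kernel.ι v ≫ aᶜ = 0` / `aᶜ ≫ cokernel.π v = 0`, and the SECTION-level forms
  "`v(s) = 0 ⇒ aᶜ s = 0`" / "every section `t` of `B` has `aᶜ t` locally in the image of `v`".

Everything is proved; no definitions.

Provenance: Literature home (family `hodge`, layer `Literature/AlgebraicGeometry/FormalGeometry`, namespace
`Literature.AlgebraicGeometry.FormalGeometry.WittGrothendieckExistence…`) of the Summits-side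
`Theorems/PadicSemiregularLiftFormalVectorBundlesAlgebraizeIsogenyTransfer` (route `PadicSemiregularLift` / `AnchorTransport`,
Grothendieck existence for vector bundles over `W(k)`), which `Literature/` may not import; theorems only, no
named fact, no definition. Lane `lit-hodgefound`, seat p20.
-/

noncomputable section

-- `TopCat.Presheaf`/`Scheme.Modules` are not reducible (as in Mathlib's `AlgebraicGeometry/Modules`).
set_option backward.isDefEq.respectTransparency false

open CategoryTheory CategoryTheory.Limits

universe v u

namespace Literature.AlgebraicGeometry.FormalGeometry.WittGrothendieckExistence.FormalVectorBundlesAlgebraize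

/-! ### §1 Abelian generalities -/

section Abelian

variable {C : Type u} [Category.{v} C] [Abelian C]
  (ε : ∀ Z : C, Z ⟶ Z) (hε : ∀ {Z Z' : C} (f : Z ⟶ Z'), ε Z ≫ f = f ≫ ε Z')

/-- A kernel bound for `v` is a kernel bound for `v ≫ m`, `m` a monomorphism. [cite: GortzWedhorn2023, proof of Thm. 24.94 and Prop. 24.95 (pp. 566–567), auxiliary step] -/
theorem kerBound_comp_mono {A B B' : C} (v : A ⟶ B) (m : B ⟶ B') [Mono m]
    (hk : ∀ {T : C} (z : T ⟶ A), z ≫ v = 0 → z ≫ ε A = 0) {T : C} (z : T ⟶ A)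
    (hz : z ≫ (v ≫ m) = 0) : z ≫ ε A = 0 := by
  refine hk z ?_
  rw [← cancel_mono m, Category.assoc, hz, zero_comp]

include hε in
/-- A kernel bound for `v` is a kernel bound for `e ≫ v`, `e` a monomorphism (e.g. an isomorphism). [cite: GortzWedhorn2023, proof of Thm. 24.94 and Prop. 24.95 (pp. 566–567), auxiliary step] -/
theorem kerBound_mono_comp {A' A B : C} (e : A' ⟶ A) [Mono e] (v : A ⟶ B)
    (hk : ∀ {T : C} (z : T ⟶ A), z ≫ v = 0 → z ≫ ε A = 0) {T : C} (z : T ⟶ A')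
    (hz : z ≫ (e ≫ v) = 0) : z ≫ ε A' = 0 := by
  have h := hk (z ≫ e) (by rw [Category.assoc, hz])
  rw [Category.assoc, ← hε e, ← Category.assoc] at h
  rw [← cancel_mono e, h, zero_comp]

/-- A cokernel bound for `v` is a cokernel bound for `e ≫ v`, `e` an epimorphism. [cite: GortzWedhorn2023, proof of Thm. 24.94 and Prop. 24.95 (pp. 566–567), auxiliary step] -/
theorem cokerBound_epi_comp {A' A B : C} (e : A' ⟶ A) [Epi e] (v : A ⟶ B)
    (hc : ∀ {T : C} (q : B ⟶ T), v ≫ q = 0 → ε B ≫ q = 0) {T : C} (q : B ⟶ T)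
    (hq : (e ≫ v) ≫ q = 0) : ε B ≫ q = 0 := by
  refine hc q ?_
  rw [← cancel_epi e, ← Category.assoc, hq, comp_zero]

include hε in
/-- A cokernel bound for `v` is a cokernel bound for `v ≫ m`, `m` an epimorphism (e.g. an isomorphism). [cite: GortzWedhorn2023, proof of Thm. 24.94 and Prop. 24.95 (pp. 566–567), auxiliary step] -/
theorem cokerBound_comp_epi {A B B' : C} (v : A ⟶ B) (m : B ⟶ B') [Epi m]
    (hc : ∀ {T : C} (q : B ⟶ T), v ≫ q = 0 → ε B ≫ q = 0) {T : C} (q : B' ⟶ T)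
    (hq : (v ≫ m) ≫ q = 0) : ε B' ≫ q = 0 := by
  have h := hc (m ≫ q) (by rw [← Category.assoc]; exact hq)
  rw [← Category.assoc, hε m, Category.assoc] at h
  rw [← cancel_epi m, h, comp_zero]

variable [HasFiniteBiproducts C] (R : C ⥤ C) [R.Additive] (η : 𝟭 C ⟶ R)

omit [R.Additive] in
include hε in
/-- **Kernel bounds are stable under finite biproducts**: if every `η_{A_j} : A_j → R(A_j)` has its
kernel killed by `ε`, so does `η_{⨁ A}` (test against the projections). [cite: GortzWedhorn2023, proof of Thm. 24.94 and Prop. 24.95 (pp. 566–567), auxiliary step] -/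
theorem kerBound_biproduct {J : Type} [Fintype J] (A : J → C)
    (hk : ∀ (j : J) {T : C} (z : T ⟶ A j), z ≫ η.app (A j) = 0 → z ≫ ε (A j) = 0) {T : C}
    (z : T ⟶ ⨁ A) (hz : z ≫ η.app (⨁ A) = 0) : z ≫ ε (⨁ A) = 0 := by
  refine biproduct.hom_ext _ _ fun j => ?_
  rw [zero_comp, Category.assoc, hε, ← Category.assoc]
  refine hk j (z ≫ biproduct.π A j) ?_
  have hnat : biproduct.π A j ≫ η.app (A j) = η.app (⨁ A) ≫ R.map (biproduct.π A j) :=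
    η.naturality (biproduct.π A j)
  rw [Category.assoc, hnat, ← Category.assoc, hz, zero_comp]

include hε in
/-- **Cokernel bounds are stable under finite biproducts**: if every `η_{A_j}` has its cokernel killed
by `ε`, so does `η_{⨁ A}` (decompose `𝟙 = Σ R(π_j) ≫ R(ι_j)` on the additive `R`). [cite: GortzWedhorn2023, proof of Thm. 24.94 and Prop. 24.95 (pp. 566–567), auxiliary step] -/
theorem cokerBound_biproduct {J : Type} [Fintype J] (A : J → C)
    (hc : ∀ (j : J) {T : C} (q : R.obj (A j) ⟶ T), η.app (A j) ≫ q = 0 → ε (R.obj (A j)) ≫ q = 0)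
    {T : C} (q : R.obj (⨁ A) ⟶ T) (hq : η.app (⨁ A) ≫ q = 0) : ε (R.obj (⨁ A)) ≫ q = 0 := by
  have htot : (𝟙 (R.obj (⨁ A)) : R.obj (⨁ A) ⟶ R.obj (⨁ A)) =
      ∑ j : J, R.map (biproduct.π A j) ≫ R.map (biproduct.ι A j) := by
    rw [← R.map_id, ← biproduct.total, R.map_sum]
    simp only [R.map_comp]
  rw [← Category.id_comp q, htot, Preadditive.sum_comp, Preadditive.comp_sum]
  refine Finset.sum_eq_zero fun j _ => ?_
  rw [Category.assoc, ← Category.assoc (ε _), hε, Category.assoc]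
  have hj : η.app (A j) ≫ (R.map (biproduct.ι A j) ≫ q) = 0 := by
    have hnat : biproduct.ι A j ≫ η.app (⨁ A) = η.app (A j) ≫ R.map (biproduct.ι A j) :=
      η.naturality (biproduct.ι A j)
    rw [← Category.assoc, ← hnat, Category.assoc, hq, comp_zero]
  rw [hc j _ hj, comp_zero]

end Abelian

/-! ### §2 `𝒪_X`-modules: the three forms of the bounds -/

section Modules

open _root_.AlgebraicGeometry TopologicalSpace Opposite
open Literature.AlgebraicGeometry.Modules Literature.AlgebraicGeometry.Motives

variable {X : Scheme.{u}} (b : Γ(X, ⊤)) {A B : X.Modules} (v : A ⟶ B)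

/-- Kernel bound: from the `kernel.ι` form to the generalized-element form. [cite: GortzWedhorn2023, proof of Thm. 24.94 and Prop. 24.95 (pp. 566–567), auxiliary step] -/
theorem kerBound_of_kernel_ι (hk : kernel.ι v ≫ globalScalar A b = 0) {T : X.Modules} (z : T ⟶ A)
    (hz : z ≫ v = 0) : z ≫ globalScalar A b = 0 := by
  rw [← kernel.lift_ι v z hz, Category.assoc, hk, comp_zero]

/-- Kernel bound: from the generalized-element form to the `kernel.ι` form. [cite: GortzWedhorn2023, proof of Thm. 24.94 and Prop. 24.95 (pp. 566–567), auxiliary step] -/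
theorem kernel_ι_of_kerBound (hk : ∀ {T : X.Modules} (z : T ⟶ A), z ≫ v = 0 → z ≫ globalScalar A b = 0) :
    kernel.ι v ≫ globalScalar A b = 0 :=
  hk _ (kernel.condition v)

/-- Cokernel bound: from the `cokernel.π` form to the generalized-element form. [cite: GortzWedhorn2023, proof of Thm. 24.94 and Prop. 24.95 (pp. 566–567), auxiliary step] -/
theorem cokerBound_of_cokernel_π (hc : globalScalar B b ≫ cokernel.π v = 0) {T : X.Modules}
    (q : B ⟶ T) (hq : v ≫ q = 0) : globalScalar B b ≫ q = 0 := by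
  rw [← cokernel.π_desc v q hq, ← Category.assoc, hc, zero_comp]

/-- Cokernel bound: from the generalized-element form to the `cokernel.π` form. [cite: GortzWedhorn2023, proof of Thm. 24.94 and Prop. 24.95 (pp. 566–567), auxiliary step] -/
theorem cokernel_π_of_cokerBound
    (hc : ∀ {T : X.Modules} (q : B ⟶ T), v ≫ q = 0 → globalScalar B b ≫ q = 0) :
    globalScalar B b ≫ cokernel.π v = 0 :=
  hc _ (cokernel.condition v)

/-- **Kernel bound on sections**: if `kernel.ι v ≫ b = 0`, a section killed by `v` is killed by `b`. [cite: GortzWedhorn2023, proof of Thm. 24.94 and Prop. 24.95 (pp. 566–567), auxiliary step] -/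
theorem smul_eq_zero_of_kernel_ι (hk : kernel.ι v ≫ globalScalar A b = 0) (U : X.Opens)
    (s : Γ(A, U)) (hs : v.app U s = 0) :
    X.presheaf.map (homOfLE (le_top : U ≤ ⊤)).op b • s = 0 := by
  obtain ⟨z, rfl⟩ := exists_kernel_ι_app_eq v U s hs
  have h := congrArg (fun φ => φ.app U z) hk
  simpa [Scheme.Modules.Hom.zero_app] using h

/-- **Kernel bound from sections**: if every section killed by `v` is killed by `b`, then
`kernel.ι v ≫ b = 0`. [cite: GortzWedhorn2023, proof of Thm. 24.94 and Prop. 24.95 (pp. 566–567), auxiliary step] -/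
theorem kernel_ι_of_sections
    (h : ∀ (U : X.Opens) (s : Γ(A, U)), v.app U s = 0 →
      X.presheaf.map (homOfLE (le_top : U ≤ ⊤)).op b • s = 0) :
    kernel.ι v ≫ globalScalar A b = 0 := by
  refine Scheme.Modules.hom_ext _ _ fun U => ?_
  ext z
  rw [Scheme.Modules.Hom.zero_app]
  change (globalScalar A b).app U ((kernel.ι v).app U z) = 0
  rw [globalScalar_app_apply]
  exact h U _ (app_kernel_ι_app v U z)

/-- **Cokernel bound on sections**: if `b ≫ cokernel.π v = 0`, then for every section `t` of `B`,
`b • t` is locally in the image of `v`. [cite: GortzWedhorn2023, proof of Thm. 24.94 and Prop. 24.95 (pp. 566–567), auxiliary step] -/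
theorem exists_local_preimage_of_cokernel_π (hc : globalScalar B b ≫ cokernel.π v = 0) (U : X.Opens)
    (t : Γ(B, U)) (x : X) (hx : x ∈ U) :
    ∃ (W : X.Opens) (hW : W ≤ U), x ∈ W ∧ ∃ s : Γ(A, W),
      v.app W s = B.presheaf.map (homOfLE hW).op (X.presheaf.map (homOfLE (le_top : U ≤ ⊤)).op b • t) := by
  -- `b • t` lies in the kernel of `cokernel.π v`, i.e. in the image of `v`
  have h0 : (cokernel.π v).app U (X.presheaf.map (homOfLE (le_top : U ≤ ⊤)).op b • t) = 0 := by
    have h := congrArg (fun φ => φ.app U t) hc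
    simpa [Scheme.Modules.Hom.zero_app] using h
  obtain ⟨w, hw⟩ := exists_kernel_ι_app_eq (cokernel.π v) U _ h0
  -- `A → im v = ker (coker v)` is an epimorphism, hence locally surjective
  obtain ⟨W, hW, hxW, s, hs⟩ :=
    Scheme.Modules.exists_app_eq_of_epi (Abelian.factorThruImage v) U w x hx
  refine ⟨W, hW, hxW, s, ?_⟩
  have hfac : v.app W s = (Abelian.image.ι v).app W ((Abelian.factorThruImage v).app W s) := by
    conv_lhs => rw [← Abelian.image.fac v]
    rfl
  have hw' : (Abelian.image.ι v).app U w =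
      X.presheaf.map (homOfLE (le_top : U ≤ ⊤)).op b • t := hw
  rw [hfac, hs, Scheme.Modules.Hom.app_map_apply, hw']

/-- **Cokernel bound from sections**: if for every section `t` of `B`, `b • t` is locally in the
image of `v`, then `b ≫ cokernel.π v = 0`. [cite: GortzWedhorn2023, proof of Thm. 24.94 and Prop. 24.95 (pp. 566–567), auxiliary step] -/
theorem cokernel_π_of_sections
    (h : ∀ (U : X.Opens) (t : Γ(B, U)) (x : X), x ∈ U → ∃ (W : X.Opens) (hW : W ≤ U), x ∈ W ∧
      ∃ s : Γ(A, W), v.app W s =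
        B.presheaf.map (homOfLE hW).op (X.presheaf.map (homOfLE (le_top : U ≤ ⊤)).op b • t)) :
    globalScalar B b ≫ cokernel.π v = 0 := by
  refine Scheme.Modules.hom_ext _ _ fun U => ?_
  ext t
  rw [Scheme.Modules.Hom.zero_app]
  change (cokernel.π v).app U ((globalScalar B b).app U t) = 0
  rw [globalScalar_app_apply]
  refine section_eq_zero_of_locally _ _ fun x hx => ?_
  obtain ⟨W, hW, hxW, s, hs⟩ := h U t x hx
  refine ⟨W, hW, hxW, ?_⟩
  rw [← Scheme.Modules.Hom.app_map_apply, ← hs]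
  change (v ≫ cokernel.π v).app W s = 0
  rw [cokernel.condition, Scheme.Modules.Hom.zero_app]
  rfl

end Modules

end Literature.AlgebraicGeometry.FormalGeometry.WittGrothendieckExistence.FormalVectorBundlesAlgebraize

end
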